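import Summits.ABC.IUTFork.Conditional.AbcOfSHregSplitHeight
import HarnessLib

/-!
# Branch C, cone binders `hvol` / `hreg` on the UNEQUAL-HEIGHTS locus: two BAD places of `ℚ(j(λ))` over one prime with different
# normalised local heights — the datum-free bound on the height DIFFERENCE (the remaining locus of TARGET #1's residue)

Proof-only file (0 definitions, no new `Prop`) of the abc-iut cell (R2 S-chain seat abc-iut-s2-p5), sequel to `AbcOfSHvolSplitHeight`
(p435094: bad/non-bad pairs) and `AbcOfSHregSplitHeight` (p443060: the same from `hreg`). The s2 scoreboard records the residue of TARGET #1
after the equal-heights locus was closed datum-free (abc-iut-s2-p4 `LDHEqualHeightsLocusHullRegime`) as «the unequal-heights locus of `λ`»: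
primes `p` over which two places of `F_mod = ℚ(j(λ))` carry DIFFERENT normalised `q`-heights `μ(u) = (−ord_u j(λ))/(2l)·ln N(u)/n_u`
(at (P5)-bad `u`; `0` otherwise). The bad/non-bad case is p435094/p443060; THIS FILE does the bad/bad case, transporting abc-iut-S7's
per-datum `PointDict.ordPairBad_le_of_hullEstimateOf` to the point exactly as before (same image of the two copies of `F_mod` in `F`):

* `PointDict.badPair_le_of_hullEstimateOf` — for ONE datum `T` with `T.HullEstimateOf δ` and (P5)-bad places `v, w` of `ℚ(j(λ))` over `p`:
  `Pr(v)·Pr(w)·(l(l+1)/12)·(μ(v) − μ(w)) ≤ δ` (both orders, so `|μ(v) − μ(w)|` is bounded);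
* `PointDict.not_slotConstant_of_unequalBadPair` — if `μ(v) ≠ μ(w)` the datum is non-slot-constant (`logQloc p v' = 2l·μ(v)`);
* **`PointDict.badPair_le_BIII_of_hreg`** — from the line-of-record cone binder `hreg` VERBATIM, at every admissible `(P, l)` and every
  bad/bad pair with `μ(v) ≠ μ(w)`: `Pr(v)·Pr(w)·(l(l+1)/12)·(μ(v) − μ(w)) ≤ B_III(P,l)`; together with p443060 this is the datum-free
  NECESSITY of `hreg` on the WHOLE unequal-heights locus (every unequal pair over a prime is bad/bad or bad/non-bad).

Nothing asserted about any point or about [IUTchIII] Cor. 3.12 / [IUTchIV] Thm. 1.10; typed ≠ proved.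
[cite: Mochizuki2012, IUTchIV Thm. 1.10 Step (v) p. 27–28] [cite: Mochizuki2012, IUTchIV Cor. 2.2 (ii) proof p. 46]
[cite: DupuyHilado2025, §3.3, §3.6, §4.7, §4.12] [claim: Mochizuki2012, status: disputed]
-/

noncomputable section

namespace Summit.ABC.IUTFork

open NumberField IsDedekindDomain Literature.IUT.LogVolume Literature.IUT.HodgeTheaters
open Literature.NumberTheory.DiophantineGeometry.GenEll
open scoped Classical

namespace PointDict

variable {P : NFPoint} {l : ℕ}

/-- **Bad/bad pairs, one datum**: `T.HullEstimateOf δ` and two (P5)-bad places `v, w` of `ℚ(j(λ))` over `p` give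
`Pr(v)·Pr(w)·(l(l+1)/12)·(μ(v) − μ(w)) ≤ δ`, AND `μ(v) ≠ μ(w)` makes `T` non-slot-constant (abc-iut-S7's `ordPairBad_le_of_hullEstimateOf`
transported along the common image of the two copies of `F_mod` in `F`). [cite: Mochizuki2012, IUTchIV Thm. 1.10 Step (v) p. 27–28]
[cite: DupuyHilado2025, §3.3, §3.6, §4.7, §4.12] [claim: Mochizuki2012, status: disputed] -/
theorem badPair_of_datum (T : Cor22.ThetaVolumeDatumAt P l) (p : ℕ) [Fact p.Prime]
    (v w : HeightOneSpectrum (𝓞 ↥(IntermediateField.adjoin ℚ ({Cor22.jInv P.x} : Set P.F))))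
    (hv : v ∈ placesOver _ p) (hw : w ∈ placesOver _ p)
    (hvj : ord _ v (Cor22.jMod P) < 0) (hv2 : ((2 : ℕ) : 𝓞 _) ∉ v.asIdeal) (hvl : ((l : ℕ) : 𝓞 _) ∉ v.asIdeal)
    (hwj : ord _ w (Cor22.jMod P) < 0) (hw2 : ((2 : ℕ) : 𝓞 _) ∉ w.asIdeal) (hwl : ((l : ℕ) : 𝓞 _) ∉ w.asIdeal) :
    (∀ {δ : ℝ}, T.HullEstimateOf δ →
      weight _ v * weight _ w * ((l : ℝ) * ((l : ℝ) + 1) / 12) *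
        (((-ord _ v (Cor22.jMod P) : ℤ) : ℝ) / (2 * (l : ℝ)) * logNorm _ v / (localDegree _ v : ℝ)
          - ((-ord _ w (Cor22.jMod P) : ℤ) : ℝ) / (2 * (l : ℝ)) * logNorm _ w / (localDegree _ w : ℝ)) ≤ δ) ∧
    ((((-ord _ v (Cor22.jMod P) : ℤ) : ℝ) / (2 * (l : ℝ)) * logNorm _ v / (localDegree _ v : ℝ) ≠
        ((-ord _ w (Cor22.jMod P) : ℤ) : ℝ) / (2 * (l : ℝ)) * logNorm _ w / (localDegree _ w : ℝ)) →
      letI := T.instFieldF; letI := T.instNumberFieldF; letI := T.instAlgebraF; letI := T.instFieldK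
      letI := T.instNumberFieldK; letI := T.instAlgebraK; letI := T.instFieldFbar; letI := T.instAlgebraFbar
      letI := T.instAlgebraKFbar; letI := T.instIsElliptic
      ¬ (∀ p ∈ T.I.supportPrimes, ∀ v w : placesOver (fieldOfModuli T.E) p,
        (Summit.ABC.IUTFork.DHData.ofInput T.I).logQloc p v = (Summit.ABC.IUTFork.DHData.ofInput T.I).logQloc p w)) := by
  letI := T.instFieldF; letI := T.instNumberFieldF; letI := T.instAlgebraF; letI := T.instFieldK
  letI := T.instNumberFieldK; letI := T.instAlgebraK; letI := T.instFieldFbar; letI := T.instAlgebraFbar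
  letI := T.instAlgebraKFbar; letI := T.instIsElliptic
  set Fm : Type := ↥(IntermediateField.adjoin ℚ ({Cor22.jInv P.x} : Set P.F)) with hFm
  letI : Algebra Fm T.F := ((algebraMap P.F T.F).comp (algebraMap Fm P.F)).toAlgebra
  have hrange : Set.range (algebraMap Fm T.F) = Set.range (algebraMap ↥(fieldOfModuli T.E) T.F) :=
    range_algebraMap_adjoin_jInv_eq T
  have hjj : algebraMap Fm T.F (Cor22.jMod P) = algebraMap ↥(fieldOfModuli T.E) T.F (ThetaData.jMod T.E) := by
    change algebraMap P.F T.F (algebraMap Fm P.F (Cor22.jMod P)) = T.E.j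
    rw [T.j_eq]
    rfl
  -- a bad place `u` of `ℚ(j(λ))` transports to a (P5)-bad prime `u'` of `F_mod(E_F)` with the same weight and height
  have bad : ∀ (u : HeightOneSpectrum (𝓞 Fm)), u ∈ placesOver Fm p → ord Fm u (Cor22.jMod P) < 0 →
      ((2 : ℕ) : 𝓞 Fm) ∉ u.asIdeal → ((l : ℕ) : 𝓞 Fm) ∉ u.asIdeal →
      ∃ u' : placesOver ↥(fieldOfModuli T.E) p, u'.1 ∈ ThetaData.badPrimesMod T.D ∧
        weight ↥(fieldOfModuli T.E) u'.1 = weight Fm u ∧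
        (ord ↥(fieldOfModuli T.E) u'.1 (ThetaData.jMod T.E) : ℝ) * logNorm _ u'.1 / (localDegree _ u'.1 : ℝ) =
          (ord Fm u (Cor22.jMod P) : ℝ) * logNorm Fm u / (localDegree Fm u : ℝ) := by
    intro u hu huj hu2 hul
    obtain ⟨x, hx⟩ := PlaceSection.exists_under_eq (F₀ := Fm) (K := T.F) u
    have hxu : finBelow Fm T.F x = u := HeightOneSpectrum.ext (by rw [← hx]; rfl)
    have hxp : x ∈ placesOver T.F p := by
      rw [mem_placesOver_iff_residueChar] at hu ⊢
      rw [← residueChar_finBelow (F := Fm), hxu, hu]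
    set u' := finBelow ↥(fieldOfModuli T.E) T.F x with hu'
    have hu'p : u' ∈ placesOver ↥(fieldOfModuli T.E) p := finBelow_mem_placesOver _ T.F hxp
    have hordx : ord T.F x T.E.j < 0 := by
      have h1 : ord Fm (finBelow Fm T.F x) (Cor22.jMod P) < 0 := by rw [hxu]; exact huj
      rw [← Cor22.ord_algebraMap_neg_iff x (Cor22.jMod P), hjj] at h1
      exact h1
    have hmult : T.E.HasMultiplicativeReductionAt x := by
      refine (T.D.isSemistable x).resolve_left fun hgood => ?_
      have hle : x.valuation T.F T.E.j ≤ 1 := valuation_j_le_one_of_hasGoodReduction_localMinimalModel x T.E hgood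
      have h0 : 0 ≤ ord T.F x T.E.j := by
        unfold ord
        rw [neg_nonneg]
        by_cases hz : x.valuation T.F T.E.j = 0
        · simp [hz]
        · rw [← WithZero.log_one]
          exact (WithZero.log_le_log hz one_ne_zero).mpr hle
      omega
    have hx2l : ∀ q ∈ ({2, l} : Finset ℕ), ((q : ℕ) : 𝓞 T.F) ∉ x.asIdeal := by
      intro q hq hmem
      have hmem' : ((q : ℕ) : 𝓞 Fm) ∈ (finBelow Fm T.F x).asIdeal :=
        (Cor22.natCast_mem_asIdeal_finBelow_iff x q).mpr hmem
      rw [hxu] at hmem'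
      simp only [Finset.mem_insert, Finset.mem_singleton] at hq
      rcases hq with rfl | rfl
      · exact hu2 hmem'
      · exact hul hmem'
    have hu'bad : u' ∈ ThetaData.badPrimesMod T.D := by
      have hVF : FinitePlace.mk x ∈ T.D.VFbad :=
        (T.isP5Choice (FinitePlace.mk x)).mpr (by rw [FinitePlace.maximalIdeal_mk]; exact ⟨hx2l, hmult⟩)
      have h1 := (ThetaData.mk_mem_VFbad_iff T.D x).mp hVF
      have he : HeightOneSpectrum.under (𝓞 ↥(fieldOfModuli T.E)) x = u' := HeightOneSpectrum.ext rfl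
      rwa [he] at h1
    refine ⟨⟨u', hu'p⟩, hu'bad, ?_, ?_⟩
    · rw [← hxu]; exact (weight_finBelow_eq_of_range_eq hrange x hxp).symm
    · have key := ord_mul_logNorm_div_localDegree_finBelow_eq (A := Fm) (B := ↥(fieldOfModuli T.E)) hjj x
      rw [hxu] at key
      exact key.symm
  obtain ⟨v', hv'bad, hwv, hμv⟩ := bad v hv hvj hv2 hvl
  obtain ⟨w', hw'bad, hww, hμw⟩ := bad w hw hwj hw2 hwl
  have e : ∀ a L n : ℝ, -a / (2 * (l : ℝ)) * L / n = -(1 / (2 * (l : ℝ))) * (a * L / n) := fun _ _ _ => by ring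
  constructor
  · intro δ h
    have hS7 := ordPairBad_le_of_hullEstimateOf T h p v' w' hv'bad hw'bad
    rw [hwv, hww] at hS7
    push_cast at hS7 ⊢
    rw [e, e, hμv, hμw] at hS7
    rw [e, e]
    exact hS7
  · intro hne hall
    have hpT : p ∈ T.I.supportPrimes := by
      have h1 := residueChar_mem_supportPrimes_of_bad T v'.1 hv'bad
      rwa [(mem_placesOver_iff_residueChar v'.1).mp v'.2] at h1
    have hS : (DHData.ofInput T.I).X.S = ThetaData.badPrimesMod T.D := by
      rw [DHData.ofInput_X, T.isVolumeInputOf.X_eq]; rfl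
    -- `logQloc p u' = ord_{u'}(q)·ln N(u')/n_{u'} = −ord_{u'}(j_E)·ln N(u')/n_{u'}` at a bad `u'`
    have hloc : ∀ u' : placesOver ↥(fieldOfModuli T.E) p, u'.1 ∈ ThetaData.badPrimesMod T.D →
        (DHData.ofInput T.I).logQloc p u' =
          -((ord ↥(fieldOfModuli T.E) u'.1 (ThetaData.jMod T.E) : ℝ) * logNorm _ u'.1 / (localDegree _ u'.1 : ℝ)) := by
      intro u' hu'
      have hmem : u'.1 ∈ (DHData.ofInput T.I).X.S := by rw [hS]; exact hu'
      have hq : (DHData.ofInput T.I).X.qDivisor u'.1 = ((DHData.ofInput T.I).X.ordq u'.1 : ℝ) := by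
        show (∑ u ∈ (DHData.ofInput T.I).X.S, FinDivisor.of u ((DHData.ofInput T.I).X.ordq u : ℝ)) u'.1 = _
        rw [Finsupp.finsetSum_apply, Finset.sum_eq_single u'.1]
        · rw [FinDivisor.of, Finsupp.single_apply, if_pos rfl]
        · intro u _ huv
          rw [FinDivisor.of, Finsupp.single_apply, if_neg huv]
        · intro h; exact absurd hmem h
      have hj : (DHData.ofInput T.I).X.jE = ThetaData.jMod T.E := by
        rw [DHData.ofInput_X, T.isVolumeInputOf.X_eq]; rfl
      unfold DHData.logQloc
      rw [hq, PilotData.ordq, hj]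
      push_cast
      ring
    have h := hall p hpT v' w'
    rw [hloc v' hv'bad, hloc w' hw'bad, neg_inj, hμv, hμw] at h
    apply hne
    push_cast
    rw [e, e, h]

/-- **THE LINE-OF-RECORD CONE BINDER `hreg` ON THE UNEQUAL-HEIGHTS LOCUS (bad/bad pairs)**: for every admissible `(λ, l)`, every rational
prime `p` and (P5)-bad places `v, w` of `F_mod = ℚ(j(λ))` over `p` (`ord j(λ) < 0`, `∤ 2l`) with DIFFERENT normalised heights
`μ(v) ≠ μ(w)` (`μ(u) = (−ord_u j(λ))/(2l)·ln N(u)/n_u`): `Pr(v)·Pr(w)·(l(l+1)/12)·(μ(v) − μ(w)) ≤ B_III(λ, l)` (apply with `v, w` swapped for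
the absolute difference). With `splitPair_le_BIII_of_hreg` (p443060) this is the datum-free necessity of `hreg` on the WHOLE residue locus of
TARGET #1. Datum by `ThetaPartII.stub_thetaData`. Nothing asserted about any point. [cite: Mochizuki2012, IUTchIV Thm. 1.10 Step (v) p. 27–28]
[cite: DupuyHilado2025, §3.3, §3.6, §4.7, §4.12] [claim: Mochizuki2012, status: disputed] -/
theorem badPair_le_BIII_of_hreg
    (hreg : ∀ P : NFPoint, P ∈ UP → ∀ l : ℕ, l.Prime → 5 ≤ l →
      Cor22.AdmitsCore P → Cor22.CondP2 P l → Cor22.CondP5 P l → Cor22.CondP6 P l →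
      ∀ T : Cor22.ThetaVolumeDatumAt P l,
        (letI := T.instFieldF; letI := T.instNumberFieldF; letI := T.instAlgebraF; letI := T.instFieldK
         letI := T.instNumberFieldK; letI := T.instAlgebraK; letI := T.instFieldFbar; letI := T.instAlgebraFbar
         letI := T.instAlgebraKFbar; letI := T.instIsElliptic
         ¬ (∀ p ∈ T.I.supportPrimes, ∀ v w : placesOver (fieldOfModuli T.E) p,
            (Summit.ABC.IUTFork.DHData.ofInput T.I).logQloc p v = (Summit.ABC.IUTFork.DHData.ofInput T.I).logQloc p w)) →
        T.HullEstimateOf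
          (((l : ℝ) + 1) / 4 *
            ((1 + 12 * (Cor22.dmod P : ℝ) / l) * (P.logDiff + Cor22.logCondAvoid P {2, l})
              + 2 * Real.log l + 52
              + 20 / 3 * Real.log (((2 ^ 12 * 3 ^ 3 * 5 * Cor22.dmod P : ℕ) : ℝ) * (l : ℝ))
                * (Nat.primeCounting (2 ^ 12 * 3 ^ 3 * 5 * Cor22.dmod P * l) : ℝ))))
    (hP : P ∈ UP) (hl : l.Prime) (h5 : 5 ≤ l) (hc : Cor22.AdmitsCore P) (hP2 : Cor22.CondP2 P l)
    (hP5 : Cor22.CondP5 P l) (hP6 : Cor22.CondP6 P l) (p : ℕ) [Fact p.Prime]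
    (v w : HeightOneSpectrum (𝓞 ↥(IntermediateField.adjoin ℚ ({Cor22.jInv P.x} : Set P.F))))
    (hv : v ∈ placesOver _ p) (hw : w ∈ placesOver _ p)
    (hvj : ord _ v (Cor22.jMod P) < 0) (hv2 : ((2 : ℕ) : 𝓞 _) ∉ v.asIdeal) (hvl : ((l : ℕ) : 𝓞 _) ∉ v.asIdeal)
    (hwj : ord _ w (Cor22.jMod P) < 0) (hw2 : ((2 : ℕ) : 𝓞 _) ∉ w.asIdeal) (hwl : ((l : ℕ) : 𝓞 _) ∉ w.asIdeal)
    (hne : ((-ord _ v (Cor22.jMod P) : ℤ) : ℝ) / (2 * (l : ℝ)) * logNorm _ v / (localDegree _ v : ℝ) ≠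
        ((-ord _ w (Cor22.jMod P) : ℤ) : ℝ) / (2 * (l : ℝ)) * logNorm _ w / (localDegree _ w : ℝ)) :
    weight _ v * weight _ w * ((l : ℝ) * ((l : ℝ) + 1) / 12) *
        (((-ord _ v (Cor22.jMod P) : ℤ) : ℝ) / (2 * (l : ℝ)) * logNorm _ v / (localDegree _ v : ℝ)
          - ((-ord _ w (Cor22.jMod P) : ℤ) : ℝ) / (2 * (l : ℝ)) * logNorm _ w / (localDegree _ w : ℝ)) ≤
      ((l : ℝ) + 1) / 4 *
        ((1 + 12 * (Cor22.dmod P : ℝ) / l) * (P.logDiff + Cor22.logCondAvoid P {2, l})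
          + 2 * Real.log l + 52
          + 20 / 3 * Real.log (((2 ^ 12 * 3 ^ 3 * 5 * Cor22.dmod P : ℕ) : ℝ) * (l : ℝ))
            * (Nat.primeCounting (2 ^ 12 * 3 ^ 3 * 5 * Cor22.dmod P * l) : ℝ)) := by
  obtain ⟨T⟩ := Summit.ABC.ABC.Theorems.ThetaPartII.stub_thetaData P hP l hl h5 hc hP2 hP5 hP6
  obtain ⟨hle, hnc⟩ := badPair_of_datum T p v w hv hw hvj hv2 hvl hwj hw2 hwl
  exact hle (hreg P hP l hl h5 hc hP2 hP5 hP6 T (hnc hne))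

end PointDict

end Summit.ABC.IUTFork

end
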